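import Summits.QuantumAdvantage.AdviceFreeQNC0.WalkFailSetHitsSharp
import Summits.QuantumAdvantage.AdviceFreeQNC0.SPSRingFail
import HarnessLib

/-!
# Route RingFrame, crux α `RingToElim` (stmt-QuantumAdvantage-19119): FAIL-SET HITS on the ring at
# the sharp block length — every polynomial device of degree `D` for the `(n+1)`-cycle errs on at
# least `2^{n−m} · Σ_{j≤D'} C(m, j)` measurement patterns, `2D + 3D' + 3 ≤ m ≤ n`

Support theorem for the crux item α in the language of the rung leaf `RingHard 2`
(`Literature…RingHLF.Rel`): the ring reading of `AdviceFreeQNC0/WalkFailSetHitsSharp.lean`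
(`ringWinU_failSetHits_sharp`: fail sets of degree-`D` strategies on `m ≥ 2D + 3D' + 3` bits are
interpolating sets for degree `D'`, via the adapted far pattern `altAlong`), transported through
the affine chart of `WalkTransport.lean` (`hasDeg_transport`; fail counts by
`SPSRingFail.card_fail_le_card_not_rel`).  Supersedes `ringRel_failSetHits`
(`RingFrameRingToElimFailSetHits.lean`, block length `2D + 4D' + 3`).

* **`ringRel_failSetHits_sharp`** — for `D ≥ 1`, `2D + 3D' + 3 ≤ m ≤ n` and every tuple `P` of
  `𝔽₂`-polynomials of degree `≤ D` on `{0,1}^{n+1}`, the relation `Rel x (P x)` FAILS for at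
  least `2^{n−m} · N_{D'}(m)` patterns `x`, `N_{D'}(m) = Σ_{j≤D'} C(m,j)`.

Numbers (deficit bits `−log₂(#FAIL/2ⁿ)`): `32.8` at `D = 20` (`D' = 18`, `m = 97`), `117.0` at
`D = 80` (`D' = 72`, `m = 379`), asymptotically `≈ 1.39·D` — against `1.596(D+2)` (degree-0
tensor floor, `RingFrameRingToElimTensorZeroFloor.lean`), `≈ 1.76·D` (`4D'` version) and `2D + 3`
(fail floor).  The cell's statement (prover qn-prover-3 gen 6; a special case / instrument for crux
α of route RingFrame); not in print.  WHAT THIS IS NOT: not a constant-loss bound (`RingHard 2` / α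
untouched); density-axis exponent `≈ 1.39`, not `< 1`; no separation claim.
-/

-- the sub-problem namespace `Summit.QuantumAdvantage.QuantumAdvantage` repeats the summit name by design (D-0017)
set_option linter.dupNamespace false

noncomputable section

namespace Summit.QuantumAdvantage.QuantumAdvantage.Theorems

open Finset Summit.QuantumAdvantage.AdviceFreeQNC0
open Literature.Computability.QuantumComplexity Literature.Computability.QuantumComplexity.RingHLF
open Literature.Computability.MetaComplexity Literature.Computability.MetaComplexity.Smolensky

/-- **FAIL-SET HITS ON THE RING, sharp block length.**  For `D ≥ 1`, `2D + 3D' + 3 ≤ m ≤ n` and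
every tuple `P` of `𝔽₂`-polynomials of degree `≤ D` on the patterns of the `(n+1)`-cycle,
`Rel x (P x)` fails for at least `2^{n−m} · Σ_{j ≤ D'} C(m, j)` patterns `x`. [folklore] -/
theorem ringRel_failSetHits_sharp (D D' : ℕ) (hD : 1 ≤ D) {m n : ℕ} (hm : 2 * D + 3 * D' + 3 ≤ m)
    (hn : m ≤ n) (P : Fin (n + 1) → CubeFn (ZMod 2) (n + 1))
    (hP : ∀ i, P i ∈ lowDeg (ZMod 2) (n + 1) D) :
    2 ^ (n - m) * numMonomials m D' ≤
      (univ.filter fun x : Fin (n + 1) → Bool => ¬ Rel x (fun i => decide (P i x = 1))).card := by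
  classical
  set z : (Fin (n + 1) → Bool) → (Fin (n + 1) → Bool) := fun x i => decide (P i x = 1) with hz
  have hdeg : ∀ g, HasDeg ((fun g u => xor (z (xOfU u) g) (tGuess (xOfU u) g)) g) D :=
    fun g => hasDeg_transport hD (P g) (hP g) g
  exact le_trans (ringWinU_failSetHits_sharp D D' hm hn (n + 2) _ hdeg)
    (SPSRingFail.card_fail_le_card_not_rel (by omega) z)

end Summit.QuantumAdvantage.QuantumAdvantage.Theorems

end
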